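import Summits.ValiantsHypothesis.ValiantsHypothesis.Theorems.PeelingLemma.Negative.PeelingLemmaFalseOfAllXDesigns
import Summits.ValiantsHypothesis.ValiantsHypothesis.Theorems.BinomialElusiveNoShortRelations

/-!
# `PeelingLemma` (crux stmt-ValiantsHypothesis-7391): false modulo all-X VECTOR designs

Negative-lane lemma (val-width-7391-p1 g2, 2026-08-27), the "generic weights" link of the all-X
refutation chain.  The landed lemma `peelingLemma_false_of_allXDesigns` (p553410) asks for all-X
designs with INTEGER potentials `α β : Fin (m-1) → ℤ` whose `2m` cross sums admit no short integer
relation.  Every construction of such designs (Cruxes/PeelingLemma/ALLX-MECHANISM.md, and the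
deterministic theta-gadget family of Cruxes/PeelingLemma/DETERMINISTIC-ALLX.md) produces instead
VECTOR potentials `α β : Fin (m-1) → (Fin s → ℤ)` over an alphabet of `s` letters, with the planted
coincidences holding as vector identities and with no short relation among the `2m` output VECTORS.
Here we prove that this vector form already refutes the crux: choosing the letter weights
`θ μ = K^s + K^μ` with `K` larger than every coefficient that a relation of length `≤ ⌊log₂ m⌋²` can
produce, the scalar exponents `⟨e, θ⟩` are positive naturals (the top digit is the coordinate sum,
assumed positive) and a short integer relation among them would be a vanishing balanced base-`K`
expansion with small digits, hence (`digits_eq_zero`) a vanishing vector relation.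

Main result: `peelingLemma_false_of_allXVectorDesigns : AllXVectorDesigns-shaped hypothesis → ¬ PeelingLemma`.
No declaration here is a definition and no conclusion asserts a Theses declaration positively.
-/

namespace Summit.ValiantsHypothesis.ValiantsHypothesis.Theorems.PeelingLemma.Negative

-- summit = sub-problem name (single-conjunct summit, D-0017 layout), so the namespace repeats it
set_option linter.dupNamespace false

open Summit.ValiantsHypothesis.ValiantsHypothesis.Theses.BinomialElusive (PeelingLemma)
open Summit.ValiantsHypothesis.ValiantsHypothesis.Theorems.BinomialElusiveNoShortRelations
  (digits_eq_zero)
open scoped BigOperators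
open Finset

/-- The weight vector `θ μ = K^s + K^μ` used to turn letter vectors into integer exponents. -/
theorem weight_pairing_eq {s : ℕ} (K : ℤ) (V : Fin s → ℤ) :
    ∑ μ, V μ * (K ^ s + K ^ (μ : ℕ)) =
      (∑ μ, V μ) * K ^ s + ∑ k ∈ Finset.range s, (fun k => if h : k < s then V ⟨k, h⟩ else 0) k * K ^ k := by
  simp only [mul_add, Finset.sum_add_distrib, Finset.sum_mul]
  congr 1
  rw [← Fin.sum_univ_eq_sum_range]
  refine Finset.sum_congr rfl fun μ _ => ?_
  simp [μ.isLt]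

/-- Balanced base-`K` uniqueness with a top digit: if `|V μ| < K` for every `μ`, `|∑ V| < K`, and
`∑_μ V μ (K^s + K^μ) = 0`, then `V = 0`. -/
theorem eq_zero_of_weight_pairing_eq_zero {s : ℕ} (K : ℤ) (hK : 0 < K) (V : Fin s → ℤ)
    (hV : ∀ μ, |V μ| < K) (hsum : |∑ μ, V μ| < K)
    (h0 : ∑ μ, V μ * (K ^ s + K ^ (μ : ℕ)) = 0) : V = 0 := by
  -- digits d_k = V_k for k < s and d_s = Σ V
  let d : ℕ → ℤ := fun k => if h : k < s then V ⟨k, h⟩ else if k = s then ∑ μ, V μ else 0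
  have hd : ∀ k < s + 1, |d k| < K := by
    intro k hk
    by_cases h : k < s
    · simp only [d, h, dif_pos]; exact hV _
    · have : k = s := by omega
      simp only [d, dif_neg, not_false_eq_true, this, lt_self_iff_false, if_true]; exact hsum
  have hds : ∑ k ∈ Finset.range (s + 1), d k * K ^ k = 0 := by
    rw [Finset.sum_range_succ]
    have htop : d s = ∑ μ, V μ := by simp [d]
    have hlow : ∑ k ∈ Finset.range s, d k * K ^ k =
        ∑ k ∈ Finset.range s, (fun k => if h : k < s then V ⟨k, h⟩ else 0) k * K ^ k := by
      refine Finset.sum_congr rfl fun k hk => ?_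
      have : k < s := Finset.mem_range.mp hk
      simp [d, this]
    have hw := weight_pairing_eq K V
    rw [h0] at hw
    rw [htop, hlow]
    linarith
  have hz := digits_eq_zero K hK (s + 1) d hd hds
  funext μ
  have := hz μ (by omega)
  simpa [d, μ.isLt] using this

/-- Entry bound for a short combination: if every entry of the vectors `x i, y i` is bounded by `B`
in absolute value and `∑ (|u i| + |u' i|) ≤ ℓ`, then every entry of `∑ (u i • x i + u' i • y i)` is
bounded by `ℓ B`. -/
theorem abs_entry_sum_le {m s : ℕ} (u u' : Fin m → ℤ) (x y : Fin m → Fin s → ℤ) (B ℓ : ℤ)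
    (hB0 : 0 ≤ B) (hx : ∀ i μ, |x i μ| ≤ B) (hy : ∀ i μ, |y i μ| ≤ B)
    (hℓ : ∑ i, (|u i| + |u' i|) ≤ ℓ) (μ : Fin s) :
    |∑ i, (u i * x i μ + u' i * y i μ)| ≤ ℓ * B := by
  calc |∑ i, (u i * x i μ + u' i * y i μ)|
      ≤ ∑ i, |u i * x i μ + u' i * y i μ| := Finset.abs_sum_le_sum_abs _ _
    _ ≤ ∑ i, (|u i| + |u' i|) * B := by
        refine Finset.sum_le_sum fun i _ => ?_
        calc |u i * x i μ + u' i * y i μ| ≤ |u i * x i μ| + |u' i * y i μ| := abs_add_le _ _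
          _ = |u i| * |x i μ| + |u' i| * |y i μ| := by rw [abs_mul, abs_mul]
          _ ≤ |u i| * B + |u' i| * B := add_le_add (mul_le_mul_of_nonneg_left (hx i μ) (abs_nonneg _))
              (mul_le_mul_of_nonneg_left (hy i μ) (abs_nonneg _))
          _ = (|u i| + |u' i|) * B := by ring
    _ = (∑ i, (|u i| + |u' i|)) * B := by rw [Finset.sum_mul]
    _ ≤ ℓ * B := mul_le_mul_of_nonneg_right hℓ hB0

/-- Positivity of the scalar exponent `⟨e, θ⟩` for `θ μ = K^s + K^μ`: if the coordinate sum of `e`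
is positive and every entry of `e` is `< K` in absolute value (with `1 ≤ K`... in fact `|e μ| ≤ K - 1`),
then `⟨e, θ⟩ > 0`. -/
theorem weight_pairing_pos {s : ℕ} (K : ℤ) (hK : 1 ≤ K) (e : Fin s → ℤ)
    (he : ∀ μ, |e μ| ≤ K - 1) (hsum : 0 < ∑ μ, e μ) :
    0 < ∑ μ, e μ * (K ^ s + K ^ (μ : ℕ)) := by
  rw [weight_pairing_eq]
  -- the low part is ≥ -(K-1) Σ_{k<s} K^k = -(K^s - 1)
  have hlow : -(K ^ s - 1) ≤
      ∑ k ∈ Finset.range s, (fun k => if h : k < s then e ⟨k, h⟩ else 0) k * K ^ k := by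
    have hgeom : (∑ k ∈ Finset.range s, K ^ k) * (K - 1) = K ^ s - 1 := geom_sum_mul K s
    have hterm : ∀ k ∈ Finset.range s,
        -((K - 1) * K ^ k) ≤ (fun k => if h : k < s then e ⟨k, h⟩ else 0) k * K ^ k := by
      intro k hk
      have hks : k < s := Finset.mem_range.mp hk
      simp only [hks, dif_pos]
      have hKk : 0 ≤ K ^ k := pow_nonneg (by linarith) k
      have h1 : -(K - 1) ≤ e ⟨k, hks⟩ := by
        have := he ⟨k, hks⟩; rw [abs_le] at this; linarith [this.1]
      nlinarith
    calc -(K ^ s - 1) = ∑ k ∈ Finset.range s, -((K - 1) * K ^ k) := by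
          rw [Finset.sum_neg_distrib, ← Finset.mul_sum, mul_comm, hgeom]
      _ ≤ _ := Finset.sum_le_sum hterm
  have hKs : 1 ≤ K ^ s := one_le_pow₀ hK
  have h1 : 1 ≤ ∑ μ, e μ := hsum
  nlinarith

/-- **`PeelingLemma` is false modulo all-X VECTOR designs.**  Suppose that for every `m₀` there is,
at some `m ≥ m₀`, an all-X design with vector potentials over an alphabet `Fin s`: registers
`j : Fin (m-1)` typed by `mono`, potentials `α j, β j : Fin s → ℤ`, outputs `i : Fin m` with binomial
registers `v i, w i` and monomial registers `a i, b i, c i, d i`, the planted coincidences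
`α(v i) + α(w i) = α(a i) + α(b i)`, `β(v i) + β(w i) = α(c i) + α(d i)` as VECTOR identities, output
vectors `e₁ i = α(v i) + β(w i)`, `e₂ i = β(v i) + α(w i)` with positive coordinate sums, and no nonzero
`(u, u')` of length `≤ ⌊log₂ m⌋²` with `∑ (u i • e₁ i + u' i • e₂ i) = 0`.  Then `PeelingLemma` fails:
weights `θ μ = K^s + K^μ` (`K` large) turn the design into an integer all-X design as required by
`peelingLemma_false_of_allXDesigns`. -/
theorem peelingLemma_false_of_allXVectorDesigns
    (H : ∀ m₀ : ℕ, ∃ m ≥ m₀, ∃ (s : ℕ) (α β : Fin (m - 1) → Fin s → ℤ) (mono : Fin (m - 1) → Bool)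
      (v w a b c d : Fin m → Fin (m - 1)) (e₁ e₂ : Fin m → Fin s → ℤ),
      (∀ i, mono (v i) = false ∧ mono (w i) = false ∧ mono (a i) = true ∧ mono (b i) = true ∧
        mono (c i) = true ∧ mono (d i) = true) ∧
      (∀ i, α (v i) + α (w i) = α (a i) + α (b i)) ∧
      (∀ i, β (v i) + β (w i) = α (c i) + α (d i)) ∧
      (∀ i, e₁ i = α (v i) + β (w i)) ∧ (∀ i, e₂ i = β (v i) + α (w i)) ∧
      (∀ i, 0 < ∑ μ, e₁ i μ) ∧ (∀ i, 0 < ∑ μ, e₂ i μ) ∧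
      (∀ u u' : Fin m → ℤ, (u, u') ≠ 0 → ∑ i, (|u i| + |u' i|) ≤ ((Nat.log 2 m ^ 2 : ℕ) : ℤ) →
        ∑ i, (u i • e₁ i + u' i • e₂ i) ≠ 0)) :
    ¬ PeelingLemma := by
  refine peelingLemma_false_of_allXDesigns fun m₀ => ?_
  obtain ⟨m, hm, s, α, β, mono, v, w, a, b, c, d, e₁, e₂, hmono, hα, hβ, he₁, he₂, hpos₁, hpos₂,
    hnorel⟩ := H m₀
  -- entry bound B for the output vectors, relation length ℓ, base K
  set ℓ : ℤ := ((Nat.log 2 m ^ 2 : ℕ) : ℤ) with hℓ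
  let B : ℤ := ∑ i, ∑ μ, (|e₁ i μ| + |e₂ i μ|)
  have hB0 : 0 ≤ B := Finset.sum_nonneg fun i _ => Finset.sum_nonneg fun μ _ => by positivity
  have hBe₁ : ∀ i μ, |e₁ i μ| ≤ B := by
    intro i μ
    calc |e₁ i μ| ≤ |e₁ i μ| + |e₂ i μ| := le_add_of_nonneg_right (abs_nonneg _)
      _ ≤ ∑ μ', (|e₁ i μ'| + |e₂ i μ'|) :=
          Finset.single_le_sum (f := fun μ' => |e₁ i μ'| + |e₂ i μ'|)
            (fun μ' _ => by positivity) (Finset.mem_univ μ)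
      _ ≤ B := Finset.single_le_sum (f := fun i' => ∑ μ', (|e₁ i' μ'| + |e₂ i' μ'|))
            (fun i' _ => Finset.sum_nonneg fun μ' _ => by positivity) (Finset.mem_univ i)
  have hBe₂ : ∀ i μ, |e₂ i μ| ≤ B := by
    intro i μ
    calc |e₂ i μ| ≤ |e₁ i μ| + |e₂ i μ| := le_add_of_nonneg_left (abs_nonneg _)
      _ ≤ ∑ μ', (|e₁ i μ'| + |e₂ i μ'|) :=
          Finset.single_le_sum (f := fun μ' => |e₁ i μ'| + |e₂ i μ'|)
            (fun μ' _ => by positivity) (Finset.mem_univ μ)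
      _ ≤ B := Finset.single_le_sum (f := fun i' => ∑ μ', (|e₁ i' μ'| + |e₂ i' μ'|))
            (fun i' _ => Finset.sum_nonneg fun μ' _ => by positivity) (Finset.mem_univ i)
  have hℓ0 : 0 ≤ ℓ := by positivity
  let K : ℤ := (s : ℤ) * (ℓ * B) + ℓ * B + B + 1
  have hK1 : 1 ≤ K := by
    have : 0 ≤ (s : ℤ) * (ℓ * B) + ℓ * B + B := by positivity
    simp only [K]; linarith
  have hK0 : 0 < K := by linarith
  -- the weights and the integer potentials
  let θ : Fin s → ℤ := fun μ => K ^ s + K ^ (μ : ℕ)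
  let pair : (Fin s → ℤ) → ℤ := fun V => ∑ μ, V μ * θ μ
  have pair_add : ∀ V W : Fin s → ℤ, pair (V + W) = pair V + pair W := by
    intro V W; simp only [pair, Pi.add_apply, add_mul, Finset.sum_add_distrib]
  have pair_smul : ∀ (z : ℤ) (V : Fin s → ℤ), pair (z • V) = z * pair V := by
    intro z V; simp only [pair, Pi.smul_apply, smul_eq_mul, mul_assoc, Finset.mul_sum]
  have pair_sum : ∀ (f : Fin m → Fin s → ℤ), pair (∑ i, f i) = ∑ i, pair (f i) := by
    intro f
    simp only [pair, Finset.sum_apply, Finset.sum_mul]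
    rw [Finset.sum_comm]
  -- positivity of the output exponents
  have hpos : ∀ (e : Fin s → ℤ), (∀ μ, |e μ| ≤ B) → 0 < ∑ μ, e μ → 0 < pair e := by
    intro e he hs
    refine weight_pairing_pos K hK1 e (fun μ => (he μ).trans ?_) hs
    have : 0 ≤ (s : ℤ) * (ℓ * B) + ℓ * B := by positivity
    simp only [K]; linarith
  let E₁ : Fin m → ℕ := fun i => (pair (e₁ i)).toNat
  let E₂ : Fin m → ℕ := fun i => (pair (e₂ i)).toNat
  have hE₁ : ∀ i, (E₁ i : ℤ) = pair (e₁ i) := fun i =>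
    Int.toNat_of_nonneg (hpos (e₁ i) (hBe₁ i) (hpos₁ i)).le
  have hE₂ : ∀ i, (E₂ i : ℤ) = pair (e₂ i) := fun i =>
    Int.toNat_of_nonneg (hpos (e₂ i) (hBe₂ i) (hpos₂ i)).le
  refine ⟨m, hm, fun j => pair (α j), fun j => pair (β j), mono, v, w, a, b, c, d, E₁, E₂, hmono,
    ?_, ?_, ?_, ?_, ?_⟩
  · intro i; rw [← pair_add, ← pair_add, hα i]
  · intro i; rw [← pair_add, ← pair_add, hβ i]
  · intro i; rw [hE₁ i, he₁ i, pair_add]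
  · intro i; rw [hE₂ i, he₂ i, pair_add]
  · intro u u' hne hlen hrel
    -- the vector combination V is nonzero but pairs to zero with small digits: contradiction
    let V : Fin s → ℤ := ∑ i, (u i • e₁ i + u' i • e₂ i)
    have hVne : V ≠ 0 := hnorel u u' hne hlen
    have hVpair : pair V = 0 := by
      rw [← hrel]
      simp only [V, pair_sum, pair_add, pair_smul, hE₁, hE₂]
    have hVentry : ∀ μ, |V μ| ≤ ℓ * B := by
      intro μ
      have hVμ : V μ = ∑ i, (u i * e₁ i μ + u' i * e₂ i μ) := by
        simp only [V, Finset.sum_apply, Pi.add_apply, Pi.smul_apply, smul_eq_mul]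
      rw [hVμ]
      exact abs_entry_sum_le u u' e₁ e₂ B ℓ hB0 hBe₁ hBe₂ hlen μ
    have hVlt : ∀ μ, |V μ| < K := by
      intro μ
      refine (hVentry μ).trans_lt ?_
      have : 0 ≤ (s : ℤ) * (ℓ * B) + B := by positivity
      simp only [K]; linarith
    have hVsum : |∑ μ, V μ| < K := by
      calc |∑ μ, V μ| ≤ ∑ μ, |V μ| := Finset.abs_sum_le_sum_abs _ _
        _ ≤ ∑ _μ : Fin s, ℓ * B := Finset.sum_le_sum fun μ _ => hVentry μ
        _ = (s : ℤ) * (ℓ * B) := by simp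
        _ < K := by
            have : 0 ≤ ℓ * B + B := by positivity
            simp only [K]; linarith
    exact hVne (eq_zero_of_weight_pairing_eq_zero K hK0 V hVlt hVsum hVpair)

end Summit.ValiantsHypothesis.ValiantsHypothesis.Theorems.PeelingLemma.Negative
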